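import Literature.Computability.Cryptography.WordRAMStructuredBlocks
import Mathlib.Algebra.BigOperators.Intervals
import Mathlib.Algebra.Order.BigOperators.Group.Finset
import Mathlib.Tactic.Ring
import Mathlib.Tactic.Linarith
import HarnessLib

/-!
# The word RAM — a table of powers of two and a small exact matrix product

Two verified structured word-RAM programs (`SProg`) that the relabelling step of Pratt's
balanced-tripartitioning algorithm uses in every repetition (K. Pratt, STOC 2024, proof of
Thm. 1.9: after choosing the permutation `σ`, the sets `σ(block copies of the k-sets)` are needed as
bit masks; tenth instalment of the proof of
`Literature.Computability.AlgebraicComplexity.pratt2024_thm_1_9`), stated generically: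

* `SProg.pow2Loop` — `PB[p] := 2^{A[p]}` for `p < M` (`pow2Loop_spec`, `7 M + 4` steps): the bit of
  the element to which position `p` is sent;
* `SProg.tabProd` — the exact (non-wrapping) product of two small tables,
  `PT[u][j] := ∑_{i<tk} BM[j][i] · PB[u][i]` for `u < r`, `j < C`, row-major
  (`tabProd_spec`): with `BM[j][i] ∈ {0,1}` the membership bits of the `j`-th `k`-subset of `[3k]`
  and `PB[u][i] = 2^{σ(3ku+i)}`, `PT[u][j]` is the bit mask of the image of the `u`-th block copy of
  that subset — three nested counting loops with invariants `TIInv ⊂ TJInv ⊂ TUInv`.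

## References

* K. Pratt, *A stronger connection between the asymptotic rank conjecture and the set cover
  conjecture*, STOC 2024, arXiv:2311.02774, §2 (proof of Thm. 1.9).
* T. Nipkow, G. Klein, *Concrete Semantics with Isabelle/HOL*, Springer 2014, §12.2.
-/

namespace Literature.Computability.Cryptography.WordRAM

open StateTransition Finset

open scoped BigOperators

/-- Word addition is addition modulo `2^w`. [folklore] -/
theorem BinOp.eval_add_mod' (w x y : ℕ) : BinOp.add.eval w x y = (x + y) % 2 ^ w := rfl

/-- Word multiplication is multiplication modulo `2^w`. [folklore] -/
theorem BinOp.eval_mul_mod' (w x y : ℕ) : BinOp.mul.eval w x y = x * y % 2 ^ w := rfl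

namespace SProg

variable {w : ℕ} {O : List ℕ → List ℕ}

/-! ## Powers of two of an array

Registers: `30` = source base `pa`, `31` = destination base `pb`, `37` = length `M`;
temporaries `82` = count, `83` = source pointer, `84` = destination pointer, `85`. -/

/-- Set-up: `cnt := M; src := pa; dst := pb`. [folklore] -/
def pow2Setup : List OpSpec :=
  [(.add, .dir 82, .dir 37, .imm 0), (.add, .dir 83, .dir 30, .imm 0), (.add, .dir 84, .dir 31, .imm 0)]

/-- Body: `t := mem[src]; t := 1 shl t; mem[dst] := t; src += 1; dst += 1; cnt -= 1`. [folklore] -/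
def pow2Body : List OpSpec :=
  [(.add, .dir 85, .ind 83, .imm 0), (.shl, .dir 85, .imm 1, .dir 85),
    (.add, .ind 84, .dir 85, .imm 0), (.add, .dir 83, .dir 83, .imm 1),
    (.add, .dir 84, .dir 84, .imm 1), (.sub, .dir 82, .dir 82, .imm 1)]

/-- `PB[p] := 2^{A[p]}`, `p < M`. [folklore] -/
def pow2Loop : SProg := seq (block pow2Setup) (whilenz (.dir 82) (block pow2Body))

/-- Invariant of `pow2Loop` after `p` entries. [folklore] -/
structure Pow2Inv (m : ℕ → ℕ) (pa pb M : ℕ) (qs : List (List ℕ)) (p : ℕ) (st : Store) : Prop where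
  queries : st.queries = qs
  r30 : st.mem 30 = pa
  r31 : st.mem 31 = pb
  r37 : st.mem 37 = M
  r82 : st.mem 82 = M - p
  r83 : st.mem 83 = pa + p
  r84 : st.mem 84 = pb + p
  written : ∀ p', p' < p → st.mem (pb + p') = 2 ^ m (pa + p')
  frame : ∀ c, c ≠ 82 → c ≠ 83 → c ≠ 84 → c ≠ 85 → ¬ (pb ≤ c ∧ c < pb + p) → st.mem c = m c

set_option linter.unusedSimpArgs false in
/-- The set-up block. [folklore] -/
theorem pow2Setup_spec {m : ℕ → ℕ} {pa pb M : ℕ} (h30 : m 30 = pa) (h31 : m 31 = pb) (h37 : m 37 = M)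
    (hpa : pa < 2 ^ w) (hpb : pb < 2 ^ w) (hM : M < 2 ^ w) (qs : List (List ℕ)) :
    ∃ st', Exec w O (block pow2Setup) ⟨m, qs⟩ st' 3 ∧ Pow2Inv m pa pb M qs 0 st' := by
  refine Exec.block_of_fwd pow2Setup qs fun Rf hR => ?_
  unfold pow2Setup at hR
  have htmp := execOps_cons_fwd hR; clear hR; obtain ⟨v1, hv1, hR⟩ := htmp
  simp -failIfUnchanged (disch := omega) only [Operand.write, Operand.read,
    Function.update_self, Function.update_of_ne, BinOp.eval_add_mod', Nat.mod_eq_of_lt,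
    Nat.add_zero, h37] at hv1 hR
  subst v1
  have htmp := execOps_cons_fwd hR; clear hR; obtain ⟨v2, hv2, hR⟩ := htmp
  simp -failIfUnchanged (disch := omega) only [Operand.write, Operand.read,
    Function.update_self, Function.update_of_ne, BinOp.eval_add_mod', Nat.mod_eq_of_lt,
    Nat.add_zero, h30] at hv2 hR
  subst v2
  have htmp := execOps_cons_fwd hR; clear hR; obtain ⟨v3, hv3, hR⟩ := htmp
  simp -failIfUnchanged (disch := omega) only [Operand.write, Operand.read,
    Function.update_self, Function.update_of_ne, BinOp.eval_add_mod', Nat.mod_eq_of_lt,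
    Nat.add_zero, h31] at hv3 hR
  subst v3
  simp only [execOps_nil] at hR
  subst hR
  refine ⟨rfl, ?_, ?_, ?_, ?_, ?_, ?_, fun p' hp' => (Nat.not_lt_zero _ hp').elim,
    fun c h82 h83 h84 h85 _ => ?_⟩ <;> dsimp only
  · simp (disch := omega) only [Function.update_of_ne, Function.update_self]; exact h30
  · simp (disch := omega) only [Function.update_of_ne, Function.update_self]; exact h31
  · simp (disch := omega) only [Function.update_of_ne, Function.update_self]; exact h37
  · simp (disch := omega) only [Function.update_of_ne, Function.update_self]; omega
  · simp (disch := omega) only [Function.update_of_ne, Function.update_self]; omega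
  · simp (disch := omega) only [Function.update_of_ne, Function.update_self]; omega
  · simp (disch := omega) only [Function.update_of_ne, Function.update_self]

set_option linter.unusedSimpArgs false in
/-- One entry. [folklore] -/
theorem pow2Body_spec {m : ℕ → ℕ} {pa pb M : ℕ} {qs : List (List ℕ)} {p : ℕ} (hp : p < M)
    (hpa : 100 ≤ pa) (hpb : 100 ≤ pb) (hpaM : pa + M < 2 ^ w) (hpbM : pb + M < 2 ^ w)
    (hdisj : pa + M ≤ pb ∨ pb + M ≤ pa) (hval : ∀ p, p < M → m (pa + p) < w)
    {st : Store} (h : Pow2Inv m pa pb M qs p st) :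
    ∃ st', Exec w O (block pow2Body) st st' 6 ∧ Pow2Inv m pa pb M qs (p + 1) st' := by
  obtain ⟨hq, h30, h31, h37, h82, h83, h84, hwr, hfr⟩ := h
  obtain ⟨mm, qq⟩ := st
  simp only at hq h30 h31 h37 h82 h83 h84 hwr hfr
  subst qq
  have hsrc : mm (pa + p) = m (pa + p) :=
    hfr _ (by omega) (by omega) (by omega) (by omega) (by rcases hdisj with h | h <;> omega)
  have hvp : m (pa + p) < w := hval p hp
  have hvw : m (pa + p) < 2 ^ w := lt_trans hvp (Nat.lt_two_pow_self)
  have hpow : 2 ^ m (pa + p) < 2 ^ w := Nat.pow_lt_pow_right (by norm_num) hvp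
  have hshl : 1 * 2 ^ m (pa + p) < 2 ^ w := by omega
  refine Exec.block_of_fwd pow2Body qs fun Rf hR => ?_
  unfold pow2Body at hR
  have htmp := execOps_cons_fwd hR; clear hR; obtain ⟨v1, hv1, hR⟩ := htmp
  simp -failIfUnchanged (disch := omega) only [Operand.write, Operand.read,
    Function.update_self, Function.update_of_ne, BinOp.eval_add_mod', Nat.mod_eq_of_lt,
    Nat.add_zero, h83, hsrc] at hv1 hR
  subst v1
  have htmp := execOps_cons_fwd hR; clear hR; obtain ⟨v2, hv2, hR⟩ := htmp
  simp -failIfUnchanged (disch := omega) only [Operand.write, Operand.read,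
    Function.update_self, Function.update_of_ne, BinOp.eval_shl_of_lt hshl, Nat.add_zero,
    Nat.one_mul] at hv2 hR
  subst v2
  have htmp := execOps_cons_fwd hR; clear hR; obtain ⟨v3, hv3, hR⟩ := htmp
  simp -failIfUnchanged (disch := omega) only [Operand.write, Operand.read,
    Function.update_self, Function.update_of_ne, BinOp.eval_add_mod', Nat.mod_eq_of_lt,
    Nat.add_zero, h84] at hv3 hR
  subst v3
  have htmp := execOps_cons_fwd hR; clear hR; obtain ⟨v4, hv4, hR⟩ := htmp
  simp -failIfUnchanged (disch := omega) only [Operand.write, Operand.read,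
    Function.update_self, Function.update_of_ne, BinOp.eval_add_mod', Nat.mod_eq_of_lt,
    Nat.add_zero, h83] at hv4 hR
  subst v4
  have htmp := execOps_cons_fwd hR; clear hR; obtain ⟨v5, hv5, hR⟩ := htmp
  simp -failIfUnchanged (disch := omega) only [Operand.write, Operand.read,
    Function.update_self, Function.update_of_ne, BinOp.eval_add_mod', Nat.mod_eq_of_lt,
    Nat.add_zero, h84] at hv5 hR
  subst v5
  have htmp := execOps_cons_fwd hR; clear hR; obtain ⟨v6, hv6, hR⟩ := htmp
  simp -failIfUnchanged (disch := omega) only [Operand.write, Operand.read,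
    Function.update_self, Function.update_of_ne, BinOp.eval_sub_of_le, Nat.add_zero, h82] at hv6 hR
  subst v6
  simp only [execOps_nil] at hR
  subst hR
  refine ⟨rfl, ?_, ?_, ?_, ?_, ?_, ?_, fun p' hp' => ?_, fun c h82' h83' h84' h85' hnc => ?_⟩ <;>
    dsimp only
  · simp (disch := omega) only [Function.update_of_ne, Function.update_self]; exact h30
  · simp (disch := omega) only [Function.update_of_ne, Function.update_self]; exact h31
  · simp (disch := omega) only [Function.update_of_ne, Function.update_self]; exact h37
  · simp (disch := omega) only [Function.update_of_ne, Function.update_self]; omega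
  · simp (disch := omega) only [Function.update_of_ne, Function.update_self]; omega
  · simp (disch := omega) only [Function.update_of_ne, Function.update_self]; omega
  · rcases Nat.lt_succ_iff_lt_or_eq.1 hp' with hlt | rfl
    · simp (disch := omega) only [Function.update_of_ne, Function.update_self]; exact hwr p' hlt
    · simp (disch := omega) only [Function.update_of_ne, Function.update_self]
  · simp (disch := omega) only [Function.update_of_ne, Function.update_self]
    exact hfr c h82' h83' h84' h85' (fun hh => hnc ⟨hh.1, by omega⟩)

/-- **`PB[p] = 2^{A[p]}`.** With the source base `pa` in `30`, the destination base `pb` in `31`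
and the length `M` in `37` (data addresses, disjoint segments, no wrap-around, entries `A[p] < w`
so that the powers are words), `pow2Loop` ends within `8 M + 4` steps with `PB[p] = 2^{A[p]}` for
`p < M` and nothing else changed outside its temporaries `82–85`. [folklore] -/
theorem pow2Loop_spec {m : ℕ → ℕ} {pa pb M : ℕ} (h30 : m 30 = pa) (h31 : m 31 = pb) (h37 : m 37 = M)
    (hpa : 100 ≤ pa) (hpb : 100 ≤ pb) (hpaM : pa + M < 2 ^ w) (hpbM : pb + M < 2 ^ w)
    (hdisj : pa + M ≤ pb ∨ pb + M ≤ pa) (hval : ∀ p, p < M → m (pa + p) < w) (qs : List (List ℕ)) :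
    ∃ st', ExecLE w O pow2Loop ⟨m, qs⟩ st' (M * 8 + 4) ∧ Pow2Inv m pa pb M qs M st' := by
  obtain ⟨st₁, hex₁, h₁⟩ := pow2Setup_spec (w := w) (O := O) h30 h31 h37 (by omega) (by omega)
    (by omega) qs
  obtain ⟨st', hex, hinv⟩ := ExecLE.whilenz_invariant (w := w) (O := O) (x := .dir 82)
    (s := block pow2Body) M 6 (fun p st => Pow2Inv m pa pb M qs p st)
    (fun p hp st hst => ⟨by rw [Operand.read_dir, hst.r82]; omega,
      by obtain ⟨st', hex, hinv⟩ := pow2Body_spec (w := w) (O := O) hp hpa hpb hpaM hpbM hdisj hval hst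
         exact ⟨st', hex.execLE, hinv⟩⟩)
    (fun st hst => by rw [Operand.read_dir, hst.r82]; omega) h₁
  exact ⟨st', (ExecLE.seq hex₁.execLE hex).mono (by omega), hinv⟩

/-! ## A small exact matrix product `PT[u][j] = ∑_i BM[j][i] · PB[u][i]`

Registers: `31` = `pb`, `32` = `bm`, `33` = `pt`, `34` = `tk` (row length), `35` = `C`,
`36` = `r`; temporaries `82` = row count, `83` = `pb + u tk`, `84` = destination pointer,
`85` = column count, `86` = `j`, `87` = inner count, `88` = `BM` pointer, `89` = `PB` pointer,
`90` = accumulator, `91`. -/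

/-- One term of an entry: `t := BM[bp]; t := t * PB[pp]; acc += t; bp += 1; pp += 1; cnt -= 1`. [folklore] -/
def tiBody : List OpSpec :=
  [(.add, .dir 91, .ind 88, .imm 0), (.mul, .dir 91, .dir 91, .ind 89),
    (.add, .dir 90, .dir 90, .dir 91), (.add, .dir 88, .dir 88, .imm 1),
    (.add, .dir 89, .dir 89, .imm 1), (.sub, .dir 87, .dir 87, .imm 1)]

/-- Before an entry: `acc := 0; bp := bm + j tk; pp := pbrow; cnt := tk`. [folklore] -/
def tjPre : List OpSpec :=
  [(.add, .dir 90, .imm 0, .imm 0), (.mul, .dir 88, .dir 86, .dir 34),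
    (.add, .dir 88, .dir 32, .dir 88), (.add, .dir 89, .dir 83, .imm 0),
    (.add, .dir 87, .dir 34, .imm 0)]

/-- After an entry: `mem[dst] := acc; dst += 1; j += 1; cnt -= 1`. [folklore] -/
def tjPost : List OpSpec :=
  [(.add, .ind 84, .dir 90, .imm 0), (.add, .dir 84, .dir 84, .imm 1),
    (.add, .dir 86, .dir 86, .imm 1), (.sub, .dir 85, .dir 85, .imm 1)]

/-- Before a row: `j := 0; cnt := C`. [folklore] -/
def tuPre : List OpSpec :=
  [(.add, .dir 86, .imm 0, .imm 0), (.add, .dir 85, .dir 35, .imm 0)]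

/-- After a row: `pbrow += tk; cnt -= 1`. [folklore] -/
def tuPost : List OpSpec :=
  [(.add, .dir 83, .dir 83, .dir 34), (.sub, .dir 82, .dir 82, .imm 1)]

/-- Set-up: `cnt := r; pbrow := pb; dst := pt`. [folklore] -/
def tSetup : List OpSpec :=
  [(.add, .dir 82, .dir 36, .imm 0), (.add, .dir 83, .dir 31, .imm 0), (.add, .dir 84, .dir 33, .imm 0)]

/-- The entry loop body, the row loop body, and the whole table product. [folklore] -/
def tjBody : SProg := seq (block tjPre) (seq (whilenz (.dir 87) (block tiBody)) (block tjPost))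

/-- One row: all `C` entries. [folklore] -/
def tuBody : SProg := seq (block tuPre) (seq (whilenz (.dir 85) tjBody) (block tuPost))

/-- **The table product** `PT[u][j] := ∑_{i<tk} BM[j][i] · PB[u][i]`. [folklore] -/
def tabProd : SProg := seq (block tSetup) (whilenz (.dir 82) tuBody)

/-- The entry `PT[u][j]` (with `pbrow = pb + u tk`). [folklore] -/
def ptVal (m : ℕ → ℕ) (bm pbrow tk j : ℕ) : ℕ := ∑ i ∈ range tk, m (bm + j * tk + i) * m (pbrow + i)

/-- Its partial sums. [folklore] -/
def ptPart (m : ℕ → ℕ) (bm pbrow tk j i : ℕ) : ℕ := ∑ i' ∈ range i, m (bm + j * tk + i') * m (pbrow + i')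

/-- Partial sums are below the full sum. [folklore] -/
theorem ptPart_le (m : ℕ → ℕ) (bm pbrow tk j : ℕ) {i : ℕ} (hi : i ≤ tk) :
    ptPart m bm pbrow tk j i ≤ ptVal m bm pbrow tk j :=
  sum_le_sum_of_subset (range_subset_range.2 hi)

/-- The static side conditions of the table product. [folklore] -/
structure TSide (w : ℕ) (m : ℕ → ℕ) (pb bm pt tk C r : ℕ) : Prop where
  hpb : 100 ≤ pb
  hbm : 100 ≤ bm
  hpt : 100 ≤ pt
  hpbE : pb + r * tk < 2 ^ w
  hbmE : bm + C * tk < 2 ^ w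
  hptE : pt + r * C < 2 ^ w
  htk : tk < 2 ^ w
  hC : C < 2 ^ w
  hr : r < 2 ^ w
  hdisj_pb : pt + r * C ≤ pb ∨ pb + r * tk ≤ pt
  hdisj_bm : pt + r * C ≤ bm ∨ bm + C * tk ≤ pt
  hbit : ∀ j i, j < C → i < tk → m (bm + j * tk + i) ≤ 1
  hpbv : ∀ u i, u < r → i < tk → m (pb + u * tk + i) < 2 ^ w
  hsum : ∀ u j, u < r → j < C → ptVal m bm (pb + u * tk) tk j < 2 ^ w

/-- Invariant of the entry loop after `i` terms (reference memory `m₀` = memory at its start). [folklore] -/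
structure TIInv (m₀ : ℕ → ℕ) (bm pbrow tk j : ℕ) (qs : List (List ℕ)) (i : ℕ) (st : Store) : Prop where
  queries : st.queries = qs
  r87 : st.mem 87 = tk - i
  r88 : st.mem 88 = bm + j * tk + i
  r89 : st.mem 89 = pbrow + i
  r90 : st.mem 90 = ptPart m₀ bm pbrow tk j i
  frame : ∀ c, c ≠ 87 → c ≠ 88 → c ≠ 89 → c ≠ 90 → c ≠ 91 → st.mem c = m₀ c

set_option linter.unusedSimpArgs false in
/-- One term. [folklore] -/
theorem tiBody_spec {m₀ : ℕ → ℕ} {bm pbrow tk j : ℕ} {qs : List (List ℕ)} {i : ℕ} (hi : i < tk)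
    (hbm : 100 ≤ bm) (hpbrow : 100 ≤ pbrow) (hbmE : bm + j * tk + tk < 2 ^ w)
    (hpbE : pbrow + tk < 2 ^ w) (hbit : ∀ i, i < tk → m₀ (bm + j * tk + i) ≤ 1)
    (hpbv : ∀ i, i < tk → m₀ (pbrow + i) < 2 ^ w) (hsum : ptVal m₀ bm pbrow tk j < 2 ^ w)
    {st : Store} (h : TIInv m₀ bm pbrow tk j qs i st) :
    ∃ st', Exec w O (block tiBody) st st' 6 ∧ TIInv m₀ bm pbrow tk j qs (i + 1) st' := by
  obtain ⟨hq, h87, h88, h89, h90, hfr⟩ := h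
  obtain ⟨mm, qq⟩ := st
  simp only at hq h87 h88 h89 h90 hfr
  subst qq
  have hb : mm (bm + j * tk + i) = m₀ (bm + j * tk + i) := hfr _ (by omega) (by omega) (by omega) (by omega) (by omega)
  have hp : mm (pbrow + i) = m₀ (pbrow + i) := hfr _ (by omega) (by omega) (by omega) (by omega) (by omega)
  have hbit1 := hbit i hi
  have hpv := hpbv i hi
  have hb2 : m₀ (bm + j * tk + i) < 2 ^ w := by omega
  have hprod : m₀ (bm + j * tk + i) * m₀ (pbrow + i) ≤ m₀ (pbrow + i) := by
    calc m₀ (bm + j * tk + i) * m₀ (pbrow + i) ≤ 1 * m₀ (pbrow + i) := Nat.mul_le_mul_right _ hbit1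
      _ = _ := one_mul _
  have hpart : ptPart m₀ bm pbrow tk j i + m₀ (bm + j * tk + i) * m₀ (pbrow + i) =
      ptPart m₀ bm pbrow tk j (i + 1) := by
    unfold ptPart; rw [sum_range_succ]
  have hle := ptPart_le m₀ bm pbrow tk j (show i + 1 ≤ tk by omega)
  refine Exec.block_of_fwd tiBody qs fun Rf hR => ?_
  unfold tiBody at hR
  have htmp := execOps_cons_fwd hR; clear hR; obtain ⟨v1, hv1, hR⟩ := htmp
  simp -failIfUnchanged (disch := omega) only [Operand.write, Operand.read,
    Function.update_self, Function.update_of_ne, BinOp.eval_add_mod', BinOp.eval_mul_mod',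
    Nat.mod_eq_of_lt, BinOp.eval_sub_of_le, Nat.add_zero, h88, hb] at hv1 hR
  subst v1
  have htmp := execOps_cons_fwd hR; clear hR; obtain ⟨v2, hv2, hR⟩ := htmp
  simp -failIfUnchanged (disch := omega) only [Operand.write, Operand.read,
    Function.update_self, Function.update_of_ne, BinOp.eval_add_mod', BinOp.eval_mul_mod',
    Nat.mod_eq_of_lt, BinOp.eval_sub_of_le, Nat.add_zero, h89, hp] at hv2 hR
  subst v2
  have htmp := execOps_cons_fwd hR; clear hR; obtain ⟨v3, hv3, hR⟩ := htmp
  simp -failIfUnchanged (disch := omega) only [Operand.write, Operand.read,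
    Function.update_self, Function.update_of_ne, BinOp.eval_add_mod', BinOp.eval_mul_mod',
    Nat.mod_eq_of_lt, BinOp.eval_sub_of_le, Nat.add_zero, h90] at hv3 hR
  subst v3
  have htmp := execOps_cons_fwd hR; clear hR; obtain ⟨v4, hv4, hR⟩ := htmp
  simp -failIfUnchanged (disch := omega) only [Operand.write, Operand.read,
    Function.update_self, Function.update_of_ne, BinOp.eval_add_mod', BinOp.eval_mul_mod',
    Nat.mod_eq_of_lt, BinOp.eval_sub_of_le, Nat.add_zero, h88] at hv4 hR
  subst v4
  have htmp := execOps_cons_fwd hR; clear hR; obtain ⟨v5, hv5, hR⟩ := htmp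
  simp -failIfUnchanged (disch := omega) only [Operand.write, Operand.read,
    Function.update_self, Function.update_of_ne, BinOp.eval_add_mod', BinOp.eval_mul_mod',
    Nat.mod_eq_of_lt, BinOp.eval_sub_of_le, Nat.add_zero, h89] at hv5 hR
  subst v5
  have htmp := execOps_cons_fwd hR; clear hR; obtain ⟨v6, hv6, hR⟩ := htmp
  simp -failIfUnchanged (disch := omega) only [Operand.write, Operand.read,
    Function.update_self, Function.update_of_ne, BinOp.eval_add_mod', BinOp.eval_mul_mod',
    Nat.mod_eq_of_lt, BinOp.eval_sub_of_le, Nat.add_zero, h87] at hv6 hR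
  subst v6
  simp only [execOps_nil] at hR
  subst hR
  refine ⟨rfl, ?_, ?_, ?_, ?_, fun c h87' h88' h89' h90' h91' => ?_⟩ <;> dsimp only
  · simp (disch := omega) only [Function.update_of_ne, Function.update_self]; omega
  · simp (disch := omega) only [Function.update_of_ne, Function.update_self]; omega
  · simp (disch := omega) only [Function.update_of_ne, Function.update_self]; omega
  · simp (disch := omega) only [Function.update_of_ne, Function.update_self]; omega
  · simp (disch := omega) only [Function.update_of_ne, Function.update_self]
    exact hfr c h87' h88' h89' h90' h91'

/-- The entry loop. [folklore] -/
theorem tiLoop_spec {m₀ : ℕ → ℕ} {bm pbrow tk j : ℕ} {qs : List (List ℕ)}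
    (hbm : 100 ≤ bm) (hpbrow : 100 ≤ pbrow) (hbmE : bm + j * tk + tk < 2 ^ w)
    (hpbE : pbrow + tk < 2 ^ w) (hbit : ∀ i, i < tk → m₀ (bm + j * tk + i) ≤ 1)
    (hpbv : ∀ i, i < tk → m₀ (pbrow + i) < 2 ^ w) (hsum : ptVal m₀ bm pbrow tk j < 2 ^ w)
    {st : Store} (h : TIInv m₀ bm pbrow tk j qs 0 st) :
    ∃ st', ExecLE w O (whilenz (.dir 87) (block tiBody)) st st' (tk * 8 + 1) ∧
      TIInv m₀ bm pbrow tk j qs tk st' :=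
  ExecLE.whilenz_invariant (w := w) (O := O) (x := .dir 87) (s := block tiBody) tk 6
    (fun i st => TIInv m₀ bm pbrow tk j qs i st)
    (fun i hi st hst => ⟨by rw [Operand.read_dir, hst.r87]; omega,
      by obtain ⟨st', hex, hinv⟩ := tiBody_spec (w := w) (O := O) hi hbm hpbrow hbmE hpbE hbit hpbv
           hsum hst
         exact ⟨st', hex.execLE, hinv⟩⟩)
    (fun st hst => by rw [Operand.read_dir, hst.r87]; omega) h

/-- Invariant of the row loop (entries) after `j` entries of row `u` (reference memory `m₁` = the
memory at the start of the row). [folklore] -/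
structure TJInv (m₁ : ℕ → ℕ) (bm tk C pbrow dst₀ : ℕ) (qs : List (List ℕ)) (j : ℕ) (st : Store) : Prop where
  queries : st.queries = qs
  r32 : st.mem 32 = bm
  r34 : st.mem 34 = tk
  r83 : st.mem 83 = pbrow
  r84 : st.mem 84 = dst₀ + j
  r85 : st.mem 85 = C - j
  r86 : st.mem 86 = j
  written : ∀ j', j' < j → st.mem (dst₀ + j') = ptVal m₁ bm pbrow tk j'
  frame : ∀ c, c ≠ 84 → c ≠ 85 → c ≠ 86 → c ≠ 87 → c ≠ 88 → c ≠ 89 → c ≠ 90 → c ≠ 91 →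
    ¬ (dst₀ ≤ c ∧ c < dst₀ + j) → st.mem c = m₁ c

/-- Side conditions of one row. [folklore] -/
structure TJSide (w : ℕ) (m₁ : ℕ → ℕ) (bm tk C pbrow dst₀ : ℕ) : Prop where
  hbm : 100 ≤ bm
  hpbrow : 100 ≤ pbrow
  hdst : 100 ≤ dst₀
  hbmE : bm + C * tk < 2 ^ w
  hpbE : pbrow + tk < 2 ^ w
  hdstE : dst₀ + C < 2 ^ w
  htk : tk < 2 ^ w
  hbm_dst : dst₀ + C ≤ bm ∨ bm + C * tk ≤ dst₀
  hpb_dst : dst₀ + C ≤ pbrow ∨ pbrow + tk ≤ dst₀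
  hbit : ∀ j i, j < C → i < tk → m₁ (bm + j * tk + i) ≤ 1
  hpbv : ∀ i, i < tk → m₁ (pbrow + i) < 2 ^ w
  hsum : ∀ j, j < C → ptVal m₁ bm pbrow tk j < 2 ^ w

set_option linter.unusedSimpArgs false in
/-- `tjPre` sets up the entry loop for entry `j`. [folklore] -/
theorem tjPre_spec {m₁ : ℕ → ℕ} {bm tk C pbrow dst₀ : ℕ} {qs : List (List ℕ)} {j : ℕ} (hj : j < C)
    (hS : TJSide w m₁ bm tk C pbrow dst₀) {st : Store} (h : TJInv m₁ bm tk C pbrow dst₀ qs j st) :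
    ∃ st', Exec w O (block tjPre) st st' 5 ∧ TIInv st'.mem bm pbrow tk j qs 0 st' ∧
      st'.mem 84 = dst₀ + j ∧ st'.mem 85 = C - j ∧ st'.mem 86 = j ∧
      (∀ c, c ≠ 87 → c ≠ 88 → c ≠ 89 → c ≠ 90 → st'.mem c = st.mem c) := by
  obtain ⟨hbm, hpbrow, hdst, hbmE, hpbE, hdstE, htk, hbm_dst, hpb_dst, hbit, hpbv, hsum⟩ := hS
  obtain ⟨hq, h32, h34, h83, h84, h85, h86, hwr, hfr⟩ := h
  obtain ⟨mm, qq⟩ := st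
  simp only at hq h32 h34 h83 h84 h85 h86 hwr hfr ⊢
  subst qq
  have hjt : j * tk + tk ≤ C * tk := by
    have := Nat.mul_le_mul_right tk hj; rw [Nat.succ_mul] at this; exact this
  refine Exec.block_of_fwd tjPre qs fun Rf hR => ?_
  unfold tjPre at hR
  have htmp := execOps_cons_fwd hR; clear hR; obtain ⟨v1, hv1, hR⟩ := htmp
  simp -failIfUnchanged (disch := omega) only [Operand.write, Operand.read,
    Function.update_self, Function.update_of_ne, BinOp.eval_add_mod', BinOp.eval_mul_mod',
    Nat.mod_eq_of_lt, BinOp.eval_sub_of_le, Nat.add_zero] at hv1 hR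
  subst v1
  have htmp := execOps_cons_fwd hR; clear hR; obtain ⟨v2, hv2, hR⟩ := htmp
  simp -failIfUnchanged (disch := omega) only [Operand.write, Operand.read,
    Function.update_self, Function.update_of_ne, BinOp.eval_add_mod', BinOp.eval_mul_mod',
    Nat.mod_eq_of_lt, BinOp.eval_sub_of_le, Nat.add_zero, h86, h34] at hv2 hR
  subst v2
  have htmp := execOps_cons_fwd hR; clear hR; obtain ⟨v3, hv3, hR⟩ := htmp
  simp -failIfUnchanged (disch := omega) only [Operand.write, Operand.read,
    Function.update_self, Function.update_of_ne, BinOp.eval_add_mod', BinOp.eval_mul_mod',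
    Nat.mod_eq_of_lt, BinOp.eval_sub_of_le, Nat.add_zero, h32] at hv3 hR
  subst v3
  have htmp := execOps_cons_fwd hR; clear hR; obtain ⟨v4, hv4, hR⟩ := htmp
  simp -failIfUnchanged (disch := omega) only [Operand.write, Operand.read,
    Function.update_self, Function.update_of_ne, BinOp.eval_add_mod', BinOp.eval_mul_mod',
    Nat.mod_eq_of_lt, BinOp.eval_sub_of_le, Nat.add_zero, h83] at hv4 hR
  subst v4
  have htmp := execOps_cons_fwd hR; clear hR; obtain ⟨v5, hv5, hR⟩ := htmp
  simp -failIfUnchanged (disch := omega) only [Operand.write, Operand.read,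
    Function.update_self, Function.update_of_ne, BinOp.eval_add_mod', BinOp.eval_mul_mod',
    Nat.mod_eq_of_lt, BinOp.eval_sub_of_le, Nat.add_zero, h34] at hv5 hR
  subst v5
  simp only [execOps_nil] at hR
  subst hR
  refine ⟨⟨rfl, ?_, ?_, ?_, ?_, fun c _ _ _ _ _ => rfl⟩, ?_, ?_, ?_, fun c h87' h88' h89' h90' => ?_⟩ <;>
    dsimp only
  · simp (disch := omega) only [Function.update_of_ne, Function.update_self]; omega
  · simp (disch := omega) only [Function.update_of_ne, Function.update_self]; omega
  · simp (disch := omega) only [Function.update_of_ne, Function.update_self]; omega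
  · simp (disch := omega) only [Function.update_of_ne, Function.update_self]; simp [ptPart]
  · simp (disch := omega) only [Function.update_of_ne, Function.update_self]; exact h84
  · simp (disch := omega) only [Function.update_of_ne, Function.update_self]; exact h85
  · simp (disch := omega) only [Function.update_of_ne, Function.update_self]; exact h86
  · simp (disch := omega) only [Function.update_of_ne, Function.update_self]

set_option linter.unusedSimpArgs false in
/-- `tjPost` stores entry `j`. [folklore] -/
theorem tjPost_spec {m₁ : ℕ → ℕ} {bm tk C pbrow dst₀ : ℕ} {qs : List (List ℕ)} {j : ℕ} (hj : j < C)
    (hS : TJSide w m₁ bm tk C pbrow dst₀) {st st₁ st₂ : Store} (h : TJInv m₁ bm tk C pbrow dst₀ qs j st)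
    (h₁ : st₁.mem 84 = dst₀ + j ∧ st₁.mem 85 = C - j ∧ st₁.mem 86 = j ∧
      (∀ c, c ≠ 87 → c ≠ 88 → c ≠ 89 → c ≠ 90 → st₁.mem c = st.mem c))
    (h₂ : TIInv st₁.mem bm pbrow tk j qs tk st₂) :
    ∃ st', Exec w O (block tjPost) st₂ st' 4 ∧ TJInv m₁ bm tk C pbrow dst₀ qs (j + 1) st' := by
  obtain ⟨hbm, hpbrow, hdst, hbmE, hpbE, hdstE, htk, hbm_dst, hpb_dst, hbit, hpbv, hsum⟩ := hS
  obtain ⟨g84, g85, g86, gfr⟩ := h₁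
  obtain ⟨hq₂, h87, h88, h89, h90, hfr⟩ := h₂
  obtain ⟨mm, qq⟩ := st₂
  simp only at hq₂ h87 h88 h89 h90 hfr
  subst qq
  have hjt : j * tk + tk ≤ C * tk := by
    have := Nat.mul_le_mul_right tk hj; rw [Nat.succ_mul] at this; exact this
  -- the accumulator holds `ptVal` of the reference memory
  have hval : ptPart st₁.mem bm pbrow tk j tk = ptVal m₁ bm pbrow tk j := by
    unfold ptPart ptVal
    refine sum_congr rfl fun i hi => ?_
    rw [mem_range] at hi
    rw [gfr (bm + j * tk + i) (by omega) (by omega) (by omega) (by omega),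
      gfr (pbrow + i) (by omega) (by omega) (by omega) (by omega),
      h.frame (bm + j * tk + i) (by omega) (by omega) (by omega) (by omega) (by omega) (by omega)
        (by omega) (by omega) (by rcases hbm_dst with hh | hh <;> omega),
      h.frame (pbrow + i) (by omega) (by omega) (by omega) (by omega) (by omega) (by omega)
        (by omega) (by omega) (by rcases hpb_dst with hh | hh <;> omega)]
  rw [hval] at h90
  have hv : ptVal m₁ bm pbrow tk j < 2 ^ w := hsum j hj
  have h84 : mm 84 = dst₀ + j := by rw [hfr 84 (by omega) (by omega) (by omega) (by omega) (by omega)]; exact g84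
  have h85 : mm 85 = C - j := by rw [hfr 85 (by omega) (by omega) (by omega) (by omega) (by omega)]; exact g85
  have h86 : mm 86 = j := by rw [hfr 86 (by omega) (by omega) (by omega) (by omega) (by omega)]; exact g86
  have hback : ∀ c, c ≠ 84 → c ≠ 85 → c ≠ 86 → c ≠ 87 → c ≠ 88 → c ≠ 89 → c ≠ 90 → c ≠ 91 →
      ¬ (dst₀ ≤ c ∧ c < dst₀ + j) → mm c = m₁ c := by
    intro c h84' h85' h86' h87' h88' h89' h90' h91' hnc
    rw [hfr c h87' h88' h89' h90' h91', gfr c h87' h88' h89' h90']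
    exact h.frame c h84' h85' h86' h87' h88' h89' h90' h91' hnc
  refine Exec.block_of_fwd tjPost qs fun Rf hR => ?_
  unfold tjPost at hR
  have htmp := execOps_cons_fwd hR; clear hR; obtain ⟨v1, hv1, hR⟩ := htmp
  simp -failIfUnchanged (disch := omega) only [Operand.write, Operand.read,
    Function.update_self, Function.update_of_ne, BinOp.eval_add_mod', BinOp.eval_mul_mod',
    Nat.mod_eq_of_lt, BinOp.eval_sub_of_le, Nat.add_zero, h84, h90] at hv1 hR
  subst v1
  have htmp := execOps_cons_fwd hR; clear hR; obtain ⟨v2, hv2, hR⟩ := htmp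
  simp -failIfUnchanged (disch := omega) only [Operand.write, Operand.read,
    Function.update_self, Function.update_of_ne, BinOp.eval_add_mod', BinOp.eval_mul_mod',
    Nat.mod_eq_of_lt, BinOp.eval_sub_of_le, Nat.add_zero, h84] at hv2 hR
  subst v2
  have htmp := execOps_cons_fwd hR; clear hR; obtain ⟨v3, hv3, hR⟩ := htmp
  simp -failIfUnchanged (disch := omega) only [Operand.write, Operand.read,
    Function.update_self, Function.update_of_ne, BinOp.eval_add_mod', BinOp.eval_mul_mod',
    Nat.mod_eq_of_lt, BinOp.eval_sub_of_le, Nat.add_zero, h86] at hv3 hR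
  subst v3
  have htmp := execOps_cons_fwd hR; clear hR; obtain ⟨v4, hv4, hR⟩ := htmp
  simp -failIfUnchanged (disch := omega) only [Operand.write, Operand.read,
    Function.update_self, Function.update_of_ne, BinOp.eval_add_mod', BinOp.eval_mul_mod',
    Nat.mod_eq_of_lt, BinOp.eval_sub_of_le, Nat.add_zero, h85] at hv4 hR
  subst v4
  simp only [execOps_nil] at hR
  subst hR
  refine ⟨rfl, ?_, ?_, ?_, ?_, ?_, ?_, fun j' hj' => ?_,
    fun c h84' h85' h86' h87' h88' h89' h90' h91' hnc => ?_⟩ <;> dsimp only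
  · simp (disch := omega) only [Function.update_of_ne, Function.update_self]
    rw [hback 32 (by omega) (by omega) (by omega) (by omega) (by omega) (by omega) (by omega)
      (by omega) (by omega), ← h.frame 32 (by omega) (by omega) (by omega) (by omega) (by omega)
      (by omega) (by omega) (by omega) (by omega)]
    exact h.r32
  · simp (disch := omega) only [Function.update_of_ne, Function.update_self]
    rw [hback 34 (by omega) (by omega) (by omega) (by omega) (by omega) (by omega) (by omega)
      (by omega) (by omega), ← h.frame 34 (by omega) (by omega) (by omega) (by omega) (by omega)
      (by omega) (by omega) (by omega) (by omega)]
    exact h.r34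
  · simp (disch := omega) only [Function.update_of_ne, Function.update_self]
    rw [hback 83 (by omega) (by omega) (by omega) (by omega) (by omega) (by omega) (by omega)
      (by omega) (by omega), ← h.frame 83 (by omega) (by omega) (by omega) (by omega) (by omega)
      (by omega) (by omega) (by omega) (by omega)]
    exact h.r83
  · simp (disch := omega) only [Function.update_of_ne, Function.update_self]; omega
  · simp (disch := omega) only [Function.update_of_ne, Function.update_self]; omega
  · simp (disch := omega) only [Function.update_of_ne, Function.update_self]
  · rcases Nat.lt_succ_iff_lt_or_eq.1 hj' with hlt | rfl
    · simp (disch := omega) only [Function.update_of_ne, Function.update_self]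
      rw [hfr (dst₀ + j') (by omega) (by omega) (by omega) (by omega) (by omega),
        gfr (dst₀ + j') (by omega) (by omega) (by omega) (by omega)]
      exact h.written j' hlt
    · simp (disch := omega) only [Function.update_of_ne, Function.update_self]
  · simp (disch := omega) only [Function.update_of_ne, Function.update_self]
    exact hback c h84' h85' h86' h87' h88' h89' h90' h91' (fun hh => hnc ⟨hh.1, by omega⟩)

/-- One entry of a row: `5 + (8 tk + 1) + 4` steps. [folklore] -/
theorem tjBody_spec {m₁ : ℕ → ℕ} {bm tk C pbrow dst₀ : ℕ} {qs : List (List ℕ)} {j : ℕ} (hj : j < C)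
    (hS : TJSide w m₁ bm tk C pbrow dst₀) {st : Store} (h : TJInv m₁ bm tk C pbrow dst₀ qs j st) :
    ∃ st', ExecLE w O tjBody st st' (tk * 8 + 10) ∧ TJInv m₁ bm tk C pbrow dst₀ qs (j + 1) st' := by
  obtain ⟨st₁, hex₁, hI, g84, g85, g86, gfr⟩ := tjPre_spec (w := w) (O := O) hj hS h
  have hjt : j * tk + tk ≤ C * tk := by
    have := Nat.mul_le_mul_right tk hj; rw [Nat.succ_mul] at this; exact this
  have hagree : ∀ c, 100 ≤ c → ¬ (dst₀ ≤ c ∧ c < dst₀ + j) → st₁.mem c = m₁ c := fun c hc hnc => by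
    rw [gfr c (by omega) (by omega) (by omega) (by omega)]
    exact h.frame c (by omega) (by omega) (by omega) (by omega) (by omega) (by omega) (by omega)
      (by omega) hnc
  have hbmE := hS.hbmE; have hpbE := hS.hpbE; have hbm := hS.hbm; have hpbrow := hS.hpbrow
  have hbit₁ : ∀ i, i < tk → st₁.mem (bm + j * tk + i) ≤ 1 := fun i hi => by
    rw [hagree _ (by omega) (by rcases hS.hbm_dst with hh | hh <;> omega)]; exact hS.hbit j i hj hi
  have hpbv₁ : ∀ i, i < tk → st₁.mem (pbrow + i) < 2 ^ w := fun i hi => by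
    rw [hagree _ (by omega) (by rcases hS.hpb_dst with hh | hh <;> omega)]; exact hS.hpbv i hi
  have hsum₁ : ptVal st₁.mem bm pbrow tk j < 2 ^ w := by
    have : ptVal st₁.mem bm pbrow tk j = ptVal m₁ bm pbrow tk j := by
      unfold ptVal
      refine sum_congr rfl fun i hi => ?_
      rw [mem_range] at hi
      rw [hagree _ (by omega) (by rcases hS.hbm_dst with hh | hh <;> omega),
        hagree _ (by omega) (by rcases hS.hpb_dst with hh | hh <;> omega)]
    rw [this]; exact hS.hsum j hj
  obtain ⟨st₂, hex₂, hI₂⟩ := tiLoop_spec (w := w) (O := O) hbm hpbrow (by omega) (by omega)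
    hbit₁ hpbv₁ hsum₁ hI
  obtain ⟨st₃, hex₃, hJ⟩ := tjPost_spec (w := w) (O := O) hj hS h ⟨g84, g85, g86, gfr⟩ hI₂
  exact ⟨st₃, ((hex₁.execLE).seq (hex₂.seq hex₃.execLE)).mono (by omega), hJ⟩

/-- One row: all `C` entries within `C (8 tk + 12) + 1` steps. [folklore] -/
theorem tjLoop_spec {m₁ : ℕ → ℕ} {bm tk C pbrow dst₀ : ℕ} {qs : List (List ℕ)}
    (hS : TJSide w m₁ bm tk C pbrow dst₀) {st : Store} (h : TJInv m₁ bm tk C pbrow dst₀ qs 0 st) :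
    ∃ st', ExecLE w O (whilenz (.dir 85) tjBody) st st' (C * (tk * 8 + 12) + 1) ∧
      TJInv m₁ bm tk C pbrow dst₀ qs C st' :=
  ExecLE.whilenz_invariant (w := w) (O := O) (x := .dir 85) (s := tjBody) C (tk * 8 + 10)
    (fun j st => TJInv m₁ bm tk C pbrow dst₀ qs j st)
    (fun j hj st hst => ⟨by rw [Operand.read_dir, hst.r85]; omega, tjBody_spec hj hS hst⟩)
    (fun st hst => by rw [Operand.read_dir, hst.r85]; omega) h

/-- Invariant of the table product after `u` rows (reference memory `m` = memory at the start of
the row loop). [folklore] -/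
structure TUInv (m : ℕ → ℕ) (pb bm pt tk C r : ℕ) (qs : List (List ℕ)) (u : ℕ) (st : Store) : Prop where
  queries : st.queries = qs
  r31 : st.mem 31 = pb
  r32 : st.mem 32 = bm
  r33 : st.mem 33 = pt
  r34 : st.mem 34 = tk
  r35 : st.mem 35 = C
  r36 : st.mem 36 = r
  r82 : st.mem 82 = r - u
  r83 : st.mem 83 = pb + u * tk
  r84 : st.mem 84 = pt + u * C
  written : ∀ u' j, u' < u → j < C → st.mem (pt + u' * C + j) = ptVal m bm (pb + u' * tk) tk j
  frame : ∀ c, ¬ (82 ≤ c ∧ c ≤ 91) → ¬ (pt ≤ c ∧ c < pt + u * C) → st.mem c = m c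

set_option linter.unusedSimpArgs false in
/-- `tuPre` sets up row `u`. [folklore] -/
theorem tuPre_spec {m : ℕ → ℕ} {pb bm pt tk C r : ℕ} {qs : List (List ℕ)} {u : ℕ}
    (hS : TSide w m pb bm pt tk C r) {st : Store} (h : TUInv m pb bm pt tk C r qs u st) :
    ∃ st', Exec w O (block tuPre) st st' 2 ∧
      TJInv st'.mem bm tk C (pb + u * tk) (pt + u * C) qs 0 st' ∧ st'.mem 82 = r - u ∧
      (∀ c, c ≠ 85 → c ≠ 86 → st'.mem c = st.mem c) := by
  obtain ⟨hpb, hbm, hpt, hpbE, hbmE, hptE, htk, hC, hr, hdisj_pb, hdisj_bm, hbit, hpbv, hsum⟩ := hS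
  obtain ⟨hq, h31, h32, h33, h34, h35, h36, h82, h83, h84, hwr, hfr⟩ := h
  obtain ⟨mm, qq⟩ := st
  simp only at hq h31 h32 h33 h34 h35 h36 h82 h83 h84 hwr hfr ⊢
  subst qq
  refine Exec.block_of_fwd tuPre qs fun Rf hR => ?_
  unfold tuPre at hR
  have htmp := execOps_cons_fwd hR; clear hR; obtain ⟨v1, hv1, hR⟩ := htmp
  simp -failIfUnchanged (disch := omega) only [Operand.write, Operand.read,
    Function.update_self, Function.update_of_ne, BinOp.eval_add_mod', BinOp.eval_mul_mod',
    Nat.mod_eq_of_lt, BinOp.eval_sub_of_le, Nat.add_zero] at hv1 hR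
  subst v1
  have htmp := execOps_cons_fwd hR; clear hR; obtain ⟨v2, hv2, hR⟩ := htmp
  simp -failIfUnchanged (disch := omega) only [Operand.write, Operand.read,
    Function.update_self, Function.update_of_ne, BinOp.eval_add_mod', BinOp.eval_mul_mod',
    Nat.mod_eq_of_lt, BinOp.eval_sub_of_le, Nat.add_zero, h35] at hv2 hR
  subst v2
  simp only [execOps_nil] at hR
  subst hR
  refine ⟨⟨rfl, ?_, ?_, ?_, ?_, ?_, ?_, fun j' hj' => (Nat.not_lt_zero _ hj').elim,
    fun c _ _ _ _ _ _ _ _ _ => rfl⟩, ?_, fun c h85' h86' => ?_⟩ <;> dsimp only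
  · simp (disch := omega) only [Function.update_of_ne, Function.update_self]; exact h32
  · simp (disch := omega) only [Function.update_of_ne, Function.update_self]; exact h34
  · simp (disch := omega) only [Function.update_of_ne, Function.update_self]; exact h83
  · simp (disch := omega) only [Function.update_of_ne, Function.update_self]; omega
  · simp (disch := omega) only [Function.update_of_ne, Function.update_self]; omega
  · simp (disch := omega) only [Function.update_of_ne, Function.update_self]
  · simp (disch := omega) only [Function.update_of_ne, Function.update_self]; exact h82
  · simp (disch := omega) only [Function.update_of_ne, Function.update_self]

set_option linter.unusedSimpArgs false in
/-- `tuPost` closes row `u`. [folklore] -/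
theorem tuPost_spec {m : ℕ → ℕ} {pb bm pt tk C r : ℕ} {qs : List (List ℕ)} {u : ℕ} (hu : u < r)
    (hS : TSide w m pb bm pt tk C r) {st st₁ st₂ : Store} (h : TUInv m pb bm pt tk C r qs u st)
    (h₁ : st₁.mem 82 = r - u ∧ (∀ c, c ≠ 85 → c ≠ 86 → st₁.mem c = st.mem c))
    (h₂ : TJInv st₁.mem bm tk C (pb + u * tk) (pt + u * C) qs C st₂) :
    ∃ st', Exec w O (block tuPost) st₂ st' 2 ∧ TUInv m pb bm pt tk C r qs (u + 1) st' := by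
  obtain ⟨hpb, hbm, hpt, hpbE, hbmE, hptE, htk, hC, hr, hdisj_pb, hdisj_bm, hbit, hpbv, hsum⟩ := hS
  obtain ⟨g82, gfr⟩ := h₁
  obtain ⟨hq₂, h32, h34, h83, h84, h85, h86, hwr, hfr⟩ := h₂
  obtain ⟨mm, qq⟩ := st₂
  simp only at hq₂ h32 h34 h83 h84 h85 h86 hwr hfr
  subst qq
  have hutk : u * tk + tk ≤ r * tk := by
    have := Nat.mul_le_mul_right tk hu; rw [Nat.succ_mul] at this; exact this
  have huC : u * C + C ≤ r * C := by
    have := Nat.mul_le_mul_right C hu; rw [Nat.succ_mul] at this; exact this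
  have hback : ∀ c, ¬ (82 ≤ c ∧ c ≤ 91) → ¬ (pt ≤ c ∧ c < pt + u * C + C) → mm c = m c := by
    intro c hc hnc
    rw [hfr c (by omega) (by omega) (by omega) (by omega) (by omega) (by omega) (by omega) (by omega)
      (by omega), gfr c (by omega) (by omega)]
    exact h.frame c hc (by omega)
  have h82 : mm 82 = r - u := by
    rw [hfr 82 (by omega) (by omega) (by omega) (by omega) (by omega) (by omega) (by omega) (by omega)
      (by omega)]; exact g82
  -- the values of row `u` in terms of the reference memory
  have hval : ∀ j, j < C → ptVal st₁.mem bm (pb + u * tk) tk j = ptVal m bm (pb + u * tk) tk j := by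
    intro j hj
    have hjt : j * tk + tk ≤ C * tk := by
      have := Nat.mul_le_mul_right tk hj; rw [Nat.succ_mul] at this; exact this
    unfold ptVal
    refine sum_congr rfl fun i hi => ?_
    rw [mem_range] at hi
    rw [gfr _ (by omega) (by omega), gfr _ (by omega) (by omega),
      h.frame _ (by omega) (by rcases hdisj_bm with hh | hh <;> omega),
      h.frame _ (by omega) (by rcases hdisj_pb with hh | hh <;> omega)]
  refine Exec.block_of_fwd tuPost qs fun Rf hR => ?_
  unfold tuPost at hR
  have htmp := execOps_cons_fwd hR; clear hR; obtain ⟨v1, hv1, hR⟩ := htmp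
  simp -failIfUnchanged (disch := omega) only [Operand.write, Operand.read,
    Function.update_self, Function.update_of_ne, BinOp.eval_add_mod', BinOp.eval_mul_mod',
    Nat.mod_eq_of_lt, BinOp.eval_sub_of_le, Nat.add_zero, h83, h34] at hv1 hR
  subst v1
  have htmp := execOps_cons_fwd hR; clear hR; obtain ⟨v2, hv2, hR⟩ := htmp
  simp -failIfUnchanged (disch := omega) only [Operand.write, Operand.read,
    Function.update_self, Function.update_of_ne, BinOp.eval_add_mod', BinOp.eval_mul_mod',
    Nat.mod_eq_of_lt, BinOp.eval_sub_of_le, Nat.add_zero, h82] at hv2 hR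
  subst v2
  simp only [execOps_nil] at hR
  subst hR
  refine ⟨rfl, ?_, ?_, ?_, ?_, ?_, ?_, ?_, ?_, ?_, fun u' j hu' hj => ?_, fun c hc hnc => ?_⟩ <;> dsimp only
  · simp (disch := omega) only [Function.update_of_ne, Function.update_self]
    rw [hback 31 (by omega) (by omega), ← h.frame 31 (by omega) (by omega)]; exact h.r31
  · simp (disch := omega) only [Function.update_of_ne, Function.update_self]; exact h32
  · simp (disch := omega) only [Function.update_of_ne, Function.update_self]
    rw [hback 33 (by omega) (by omega), ← h.frame 33 (by omega) (by omega)]; exact h.r33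
  · simp (disch := omega) only [Function.update_of_ne, Function.update_self]; exact h34
  · simp (disch := omega) only [Function.update_of_ne, Function.update_self]
    rw [hback 35 (by omega) (by omega), ← h.frame 35 (by omega) (by omega)]; exact h.r35
  · simp (disch := omega) only [Function.update_of_ne, Function.update_self]
    rw [hback 36 (by omega) (by omega), ← h.frame 36 (by omega) (by omega)]; exact h.r36
  · simp (disch := omega) only [Function.update_of_ne, Function.update_self]; omega
  · simp (disch := omega) only [Function.update_of_ne, Function.update_self]; rw [Nat.succ_mul]; omega
  · simp (disch := omega) only [Function.update_of_ne, Function.update_self]; rw [h84, Nat.succ_mul, Nat.add_assoc]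
  · have hin : u' * C + j < u' * C + C := by omega
    simp (disch := omega) only [Function.update_of_ne, Function.update_self]
    rcases Nat.lt_succ_iff_lt_or_eq.1 hu' with hlt | rfl
    · have hu'C : u' * C + C ≤ u * C := by
        have := Nat.mul_le_mul_right C hlt; rw [Nat.succ_mul] at this; exact this
      rw [hfr _ (by omega) (by omega) (by omega) (by omega) (by omega) (by omega) (by omega)
        (by omega) (by omega), gfr _ (by omega) (by omega)]
      exact h.written u' j hlt hj
    · rw [hwr j hj, hval j hj]
  · simp (disch := omega) only [Function.update_of_ne, Function.update_self]
    exact hback c hc (fun hh => hnc ⟨hh.1, by rw [Nat.succ_mul]; omega⟩)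

/-- One row of the table product. [folklore] -/
theorem tuBody_spec {m : ℕ → ℕ} {pb bm pt tk C r : ℕ} {qs : List (List ℕ)} {u : ℕ} (hu : u < r)
    (hS : TSide w m pb bm pt tk C r) {st : Store} (h : TUInv m pb bm pt tk C r qs u st) :
    ∃ st', ExecLE w O tuBody st st' (C * (tk * 8 + 12) + 5) ∧ TUInv m pb bm pt tk C r qs (u + 1) st' := by
  obtain ⟨st₁, hex₁, hJ, g82, gfr⟩ := tuPre_spec (w := w) (O := O) hS h
  have hutk : u * tk + tk ≤ r * tk := by
    have := Nat.mul_le_mul_right tk hu; rw [Nat.succ_mul] at this; exact this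
  have huC : u * C + C ≤ r * C := by
    have := Nat.mul_le_mul_right C hu; rw [Nat.succ_mul] at this; exact this
  have hagree : ∀ c, 100 ≤ c → ¬ (pt ≤ c ∧ c < pt + u * C) → st₁.mem c = m c := fun c hc hnc => by
    rw [gfr c (by omega) (by omega)]; exact h.frame c (by omega) hnc
  have hpb := hS.hpb; have hbm := hS.hbm; have hpt := hS.hpt
  have hpbE := hS.hpbE; have hbmE := hS.hbmE; have hptE := hS.hptE
  have hJS : TJSide w st₁.mem bm tk C (pb + u * tk) (pt + u * C) := by
    refine ⟨hbm, by omega, by omega, hbmE, by omega, by omega, hS.htk, ?_, ?_,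
      fun j i hj hi => ?_, fun i hi => ?_, fun j hj => ?_⟩
    · rcases hS.hdisj_bm with hh | hh
      · exact Or.inl (by omega)
      · exact Or.inr (by omega)
    · rcases hS.hdisj_pb with hh | hh
      · exact Or.inl (by omega)
      · exact Or.inr (by omega)
    · have hjt : j * tk + tk ≤ C * tk := by
        have := Nat.mul_le_mul_right tk hj; rw [Nat.succ_mul] at this; exact this
      rw [hagree _ (by omega) (by rcases hS.hdisj_bm with hh | hh <;> omega)]
      exact hS.hbit j i hj hi
    · rw [hagree _ (by omega) (by rcases hS.hdisj_pb with hh | hh <;> omega)]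
      exact hS.hpbv u i hu hi
    · have hjt : j * tk + tk ≤ C * tk := by
        have := Nat.mul_le_mul_right tk hj; rw [Nat.succ_mul] at this; exact this
      have : ptVal st₁.mem bm (pb + u * tk) tk j = ptVal m bm (pb + u * tk) tk j := by
        unfold ptVal
        refine sum_congr rfl fun i hi => ?_
        rw [mem_range] at hi
        rw [hagree _ (by omega) (by rcases hS.hdisj_bm with hh | hh <;> omega),
          hagree _ (by omega) (by rcases hS.hdisj_pb with hh | hh <;> omega)]
      rw [this]; exact hS.hsum u j hu hj
  obtain ⟨st₂, hex₂, hJ₂⟩ := tjLoop_spec (w := w) (O := O) hJS hJ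
  obtain ⟨st₃, hex₃, hU⟩ := tuPost_spec (w := w) (O := O) hu hS h ⟨g82, gfr⟩ hJ₂
  exact ⟨st₃, ((hex₁.execLE).seq (hex₂.seq hex₃.execLE)).mono (by omega), hU⟩

set_option linter.unusedSimpArgs false in
/-- **The table product on the word RAM.** With `pb, bm, pt, tk, C, r` in registers `31–36`
(side conditions `TSide`: data addresses, tables inside the address space, the product table
disjoint from its factors, `BM` entries `≤ 1`, no entry of the product wraps), `tabProd` ends within
`r (C (8 tk + 12) + 7) + 4` steps with `PT[u][j] = ∑_{i<tk} BM[j][i] · PB[u][i]` at `pt + u C + j`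
for all `u < r`, `j < C`, and nothing changed outside its temporaries `82–91` and the product table.
[folklore] -/
theorem tabProd_spec {m : ℕ → ℕ} {pb bm pt tk C r : ℕ} (hS : TSide w m pb bm pt tk C r)
    (h31 : m 31 = pb) (h32 : m 32 = bm) (h33 : m 33 = pt) (h34 : m 34 = tk) (h35 : m 35 = C)
    (h36 : m 36 = r) (qs : List (List ℕ)) :
    ∃ st', ExecLE w O tabProd ⟨m, qs⟩ st' (r * (C * (tk * 8 + 12) + 7) + 4) ∧
      TUInv m pb bm pt tk C r qs r st' := by
  have hpb := hS.hpb; have hpt := hS.hpt; have hpbE := hS.hpbE; have hptE := hS.hptE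
  have hr := hS.hr
  obtain ⟨st₁, hex₁, hU⟩ : ∃ st', Exec w O (block tSetup) ⟨m, qs⟩ st' 3 ∧
      TUInv m pb bm pt tk C r qs 0 st' := by
    refine Exec.block_of_fwd tSetup qs fun Rf hR => ?_
    unfold tSetup at hR
    have htmp := execOps_cons_fwd hR; clear hR; obtain ⟨v1, hv1, hR⟩ := htmp
    simp -failIfUnchanged (disch := omega) only [Operand.write, Operand.read,
      Function.update_self, Function.update_of_ne, BinOp.eval_add_mod', BinOp.eval_mul_mod',
      Nat.mod_eq_of_lt, BinOp.eval_sub_of_le, Nat.add_zero, h36] at hv1 hR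
    subst v1
    have htmp := execOps_cons_fwd hR; clear hR; obtain ⟨v2, hv2, hR⟩ := htmp
    simp -failIfUnchanged (disch := omega) only [Operand.write, Operand.read,
      Function.update_self, Function.update_of_ne, BinOp.eval_add_mod', BinOp.eval_mul_mod',
      Nat.mod_eq_of_lt, BinOp.eval_sub_of_le, Nat.add_zero, h31] at hv2 hR
    subst v2
    have htmp := execOps_cons_fwd hR; clear hR; obtain ⟨v3, hv3, hR⟩ := htmp
    simp -failIfUnchanged (disch := omega) only [Operand.write, Operand.read,
      Function.update_self, Function.update_of_ne, BinOp.eval_add_mod', BinOp.eval_mul_mod',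
      Nat.mod_eq_of_lt, BinOp.eval_sub_of_le, Nat.add_zero, h33] at hv3 hR
    subst v3

    simp only [execOps_nil] at hR
    subst hR
    refine ⟨rfl, ?_, ?_, ?_, ?_, ?_, ?_, ?_, ?_, ?_, fun u' j hu' _ => (Nat.not_lt_zero _ hu').elim,
      fun c hc _ => ?_⟩ <;> dsimp only
    · simp (disch := omega) only [Function.update_of_ne, Function.update_self]; exact h31
    · simp (disch := omega) only [Function.update_of_ne, Function.update_self]; exact h32
    · simp (disch := omega) only [Function.update_of_ne, Function.update_self]; exact h33
    · simp (disch := omega) only [Function.update_of_ne, Function.update_self]; exact h34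
    · simp (disch := omega) only [Function.update_of_ne, Function.update_self]; exact h35
    · simp (disch := omega) only [Function.update_of_ne, Function.update_self]; exact h36
    · simp (disch := omega) only [Function.update_of_ne, Function.update_self]; omega
    · simp (disch := omega) only [Function.update_of_ne, Function.update_self]; omega
    · simp (disch := omega) only [Function.update_of_ne, Function.update_self]; omega
    · simp (disch := omega) only [Function.update_of_ne, Function.update_self]
  obtain ⟨st', hex, hinv⟩ := ExecLE.whilenz_invariant (w := w) (O := O) (x := .dir 82) (s := tuBody)
    r (C * (tk * 8 + 12) + 5) (fun u st => TUInv m pb bm pt tk C r qs u st)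
    (fun u hu st hst => ⟨by rw [Operand.read_dir, hst.r82]; omega, tuBody_spec hu hS hst⟩)
    (fun st hst => by rw [Operand.read_dir, hst.r82]; omega) hU
  rw [show C * (tk * 8 + 12) + 5 + 2 = C * (tk * 8 + 12) + 7 by omega] at hex
  exact ⟨st', (ExecLE.seq hex₁.execLE hex).mono (by omega), hinv⟩

end SProg

end Literature.Computability.Cryptography.WordRAM
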